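import Literature.AlgebraicGeometry.Hu2025.Proofs.S04ModelV.GoverningCount
import Mathlib.Tactic.LinearCombination
import Mathlib.Tactic.NormNum
import HarnessLib

/-!
# Hu 2025 row 105 — the AS-PRINTED renderings of (4.46)/(4.47) are refutable AS TYPED (kernel evidence for the lanes' vacuity column; D-lane)

`not_Eq4_46_of_two_ne_zero`, `not_Eq4_47_of_two_ne_zero`: over any coefficient ring with `2 ≠ 0`, for any model datum with
`rel (head F) = F` and a block with a second term, the literal `𝓑^gov_F` (both orientations of (4.39)) is not the one-orientation list of
(4.46) and has more than `|S_F| − 1` members. READING artefacts of the literal typing — «refutable as typed», NOT «refuted in print»; the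
printed content is carried by `Eq4_46_ours` / `Eq4_47_ours` (`eq4_46_ours_of_nontrivial`, `eq4_47_ours_of_nontrivial`).
Bookkeeping on OUR typed carriers of rows 101/103/105 ([claim: Hu2025, status: under-review] statements are candidates, never asserted); nothing about the manuscript's mathematics is decided here. AI-written; weaker than expert review.
-/

noncomputable section

namespace Literature.AlgebraicGeometry.Hu2025.Proofs.S04ModelV

open MvPolynomial Literature.AlgebraicGeometry.Hu2025.Statements.S04ModelV

universe u v w x

variable {k : Type u} [CommRing k] {σ : Type v} {T : Type w} {𝔗 : Type x}

/-- **`Eq4_46` AS TYPED is refutable** on any model datum with a block of at least two terms, over any coefficient ring with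
`2 ≠ 0`: the literal `𝓑^gov_F` contains `−B_{F,a}` (the orientation `(head F, a)` of (4.39)), which is none of the listed `B_{F,s}`.
A READING artefact of the literal rendering (both orientations in (4.39)), recorded for the lanes' vacuity column next to
`eq4_46_ours_of_nontrivial`; it says nothing about the manuscript's mathematics. [cite: Hu2025, §4.5 (4.39)/(4.46), chunks p0031 l.135–140 / p0032 l.9–24 (unrefereed preprint arXiv:2507.21400v1 under adjudication, D-0012/D-0089 — kernel support on OUR typed carriers of rows 103/105; nothing of the source asserted)] -/
theorem not_Eq4_46_of_two_ne_zero (h2 : (2 : k) ≠ 0) (rel : T → 𝔗) (mono : T → (σ →₀ ℕ)) (head : 𝔗 → T)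
    (hhead : ∀ F, rel (head F) = F) (F : 𝔗) (a : T) (ha : rel a = F) (hne : a ≠ head F) :
    ¬ Eq4_46 (k := k) (σ := σ) rel mono head := by
  classical
  haveI : Nontrivial k := ⟨⟨2, 0, h2⟩⟩
  intro h
  have hF := h F
  -- `−B_{F,a} ∈ 𝓑^gov_F` (the `⊇` half of `eq4_46_ours_of_nontrivial`)
  have hmem : -govBinomial (k := k) mono head F a ∈ Bgov (k := k) rel mono head F := by
    rw [eq4_46_ours_of_nontrivial (k := k) rel mono head hhead F]
    exact ⟨a, ha, hne, Or.inr rfl⟩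
  rw [hF] at hmem
  obtain ⟨s, -, hs, hEq⟩ := hmem
  -- compare the coefficient at the exponent of `x̄_{head F} · x_{(a)}`: `−1` on the left, `0` or `+1` on the right
  have hc := congrArg (coeff (((mono (head F)).mapDomain Sum.inl + Finsupp.single (Sum.inr a) 1 : σ ⊕ T →₀ ℕ))) hEq
  simp only [govBinomial, coeff_neg, wpBinomial_eq, coeff_sub, coeff_monomial] at hc
  have hne1 : ((mono a).mapDomain Sum.inl + Finsupp.single (Sum.inr (head F)) 1 : σ ⊕ T →₀ ℕ) ≠
      ((mono (head F)).mapDomain Sum.inl + Finsupp.single (Sum.inr a) 1 : σ ⊕ T →₀ ℕ) := wpExp_ne mono (Ne.symm hne)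
  by_cases hsa : s = a
  · subst hsa
    simp only [if_neg hne1, if_true, sub_zero] at hc
    -- `1 = -1`, i.e. `2 = 0`
    apply h2
    linear_combination -hc
  · have hne2 : ((mono (head F)).mapDomain Sum.inl + Finsupp.single (Sum.inr s) 1 : σ ⊕ T →₀ ℕ) ≠
        ((mono (head F)).mapDomain Sum.inl + Finsupp.single (Sum.inr a) 1 : σ ⊕ T →₀ ℕ) := by
      intro e
      have := congrArg (fun d => d (Sum.inr a)) e
      rw [wpExp_inr_self, wpExp_inr_of_ne mono (head F) s (Ne.symm hsa)] at this
      exact zero_ne_one this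
    have hne3 : ((mono s).mapDomain Sum.inl + Finsupp.single (Sum.inr (head F)) 1 : σ ⊕ T →₀ ℕ) ≠
        ((mono (head F)).mapDomain Sum.inl + Finsupp.single (Sum.inr a) 1 : σ ⊕ T →₀ ℕ) := by
      intro e
      have := congrArg (fun d => d (Sum.inr a)) e
      rw [wpExp_inr_self, wpExp_inr_of_ne mono s (head F) hne] at this
      exact zero_ne_one this
    simp only [if_neg hne1, if_true, if_neg hne2, if_neg hne3, sub_zero] at hc
    -- `-1 = 0`
    exact one_ne_zero (neg_eq_zero.mp hc)

end Literature.AlgebraicGeometry.Hu2025.Proofs.S04ModelV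

end

noncomputable section

namespace Literature.AlgebraicGeometry.Hu2025.Proofs.S04ModelV

open MvPolynomial Literature.AlgebraicGeometry.Hu2025.Statements.S04ModelV

universe u v w x

variable {k : Type u} [CommRing k] {σ : Type v} {T : Type w} {𝔗 : Type x}

/-- `B_{F,s} ≠ −B_{F,s′}` when `2 ≠ 0`: a governing binomial is never the negative of a governing binomial of the same block. [cite: Hu2025, §4.5 (4.41)/(4.46)/(4.47), chunks p0031 l.175–181 / p0032 l.9–24, l.41–49 (unrefereed preprint arXiv:2507.21400v1 under adjudication, D-0012/D-0089 — kernel support on OUR typed carriers of rows 103/105; nothing of the source asserted)] -/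
theorem govBinomial_ne_neg (h2 : (2 : k) ≠ 0) (mono : T → (σ →₀ ℕ)) (head : 𝔗 → T) (F : 𝔗) {s s' : T}
    (hs : s ≠ head F) :
    govBinomial (k := k) mono head F s ≠ -govBinomial (k := k) mono head F s' := by
  classical
  haveI : Nontrivial k := ⟨⟨2, 0, h2⟩⟩
  intro hEq
  have hc := congrArg (coeff (((mono (head F)).mapDomain Sum.inl + Finsupp.single (Sum.inr s) 1 : σ ⊕ T →₀ ℕ))) hEq
  simp only [govBinomial, coeff_neg, wpBinomial_eq, coeff_sub, coeff_monomial] at hc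
  have hne1 : ((mono s).mapDomain Sum.inl + Finsupp.single (Sum.inr (head F)) 1 : σ ⊕ T →₀ ℕ) ≠
      ((mono (head F)).mapDomain Sum.inl + Finsupp.single (Sum.inr s) 1 : σ ⊕ T →₀ ℕ) := wpExp_ne mono (Ne.symm hs)
  have hne3 : ((mono s').mapDomain Sum.inl + Finsupp.single (Sum.inr (head F)) 1 : σ ⊕ T →₀ ℕ) ≠
      ((mono (head F)).mapDomain Sum.inl + Finsupp.single (Sum.inr s) 1 : σ ⊕ T →₀ ℕ) := by
    intro e
    have := congrArg (fun d => d (Sum.inr s)) e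
    rw [wpExp_inr_self, wpExp_inr_of_ne mono s' (head F) hs] at this
    exact zero_ne_one this
  by_cases hss : s' = s
  · subst hss
    simp only [if_true, if_neg hne1, sub_zero] at hc
    apply h2
    linear_combination hc
  · have hne2 : ((mono (head F)).mapDomain Sum.inl + Finsupp.single (Sum.inr s') 1 : σ ⊕ T →₀ ℕ) ≠
        ((mono (head F)).mapDomain Sum.inl + Finsupp.single (Sum.inr s) 1 : σ ⊕ T →₀ ℕ) := by
      intro e
      have := congrArg (fun d => d (Sum.inr s)) e
      rw [wpExp_inr_self, wpExp_inr_of_ne mono (head F) s' (Ne.symm hss)] at this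
      exact zero_ne_one this
    simp only [if_true, if_neg hne1, if_neg hne2, if_neg hne3, sub_zero] at hc
    norm_num at hc

/-- **`Eq4_47` AS TYPED is refutable** (finite term type, `2 ≠ 0`, a block with a second term): the literal `𝓑^gov_F` counts both
orientations, so it has MORE than `|S_F| − 1` members (the `|S_F| − 1` binomials `B_{F,s}` and, in addition, `−B_{F,a}`). READING artefact
of the literal rendering, for the lanes' vacuity column next to `eq4_47_ours_of_nontrivial`. [cite: Hu2025, §4.5 (4.41)/(4.46)/(4.47), chunks p0031 l.175–181 / p0032 l.9–24, l.41–49 (unrefereed preprint arXiv:2507.21400v1 under adjudication, D-0012/D-0089 — kernel support on OUR typed carriers of rows 103/105; nothing of the source asserted)] -/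
theorem not_Eq4_47_of_two_ne_zero [Finite T] (h2 : (2 : k) ≠ 0) (rel : T → 𝔗) (mono : T → (σ →₀ ℕ)) (head : 𝔗 → T)
    (hhead : ∀ F, rel (head F) = F) (F : 𝔗) (a : T) (ha : rel a = F) (hne : a ≠ head F) :
    ¬ Eq4_47 (k := k) (σ := σ) rel mono head := by
  classical
  haveI : Nontrivial k := ⟨⟨2, 0, h2⟩⟩
  intro h
  have hF := h F
  -- the literal set, via `eq4_46_ours_of_nontrivial`
  have hB := eq4_46_ours_of_nontrivial (k := k) rel mono head hhead F
  -- an injection from `Option {s // rel s = F ∧ s ≠ head F}` into `Bgov F`: `none ↦ −B_{F,a}`, `some s ↦ B_{F,s}`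
  let X := {s : T // rel s = F ∧ s ≠ head F}
  let g : Option X → Bgov (k := k) rel mono head F := fun o =>
    match o with
    | none => ⟨-govBinomial (k := k) mono head F a, by rw [hB]; exact ⟨a, ha, hne, Or.inr rfl⟩⟩
    | some s => ⟨govBinomial (k := k) mono head F s.1, by rw [hB]; exact ⟨s.1, s.2.1, s.2.2, Or.inl rfl⟩⟩
  have hg : Function.Injective g := by
    intro o o' hoo
    rcases o with _ | s <;> rcases o' with _ | s'
    · rfl
    · exact absurd (congrArg Subtype.val hoo).symm (govBinomial_ne_neg h2 mono head F s'.2.2)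
    · exact absurd (congrArg Subtype.val hoo) (govBinomial_ne_neg h2 mono head F s.2.2)
    · have := congrArg Subtype.val hoo
      exact congrArg some (Subtype.ext (govBinomial_injOn (k := k) mono head F s.2.2 s'.2.2 this))
  -- `Bgov F` is finite (inside the finite set of all `±B`'s) and the count contradicts `Eq4_47`
  haveI : Finite (Bgov (k := k) rel mono head F) := by
    rw [hB]
    have : {f : ModelRing σ T k | ∃ s : T, rel s = F ∧ s ≠ head F ∧
        (f = govBinomial (k := k) mono head F s ∨ f = -govBinomial (k := k) mono head F s)} ⊆
        Set.range (fun p : T × Bool => if p.2 then govBinomial (k := k) mono head F p.1 else -govBinomial (k := k) mono head F p.1) := by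
      rintro f ⟨s, -, -, hf | hf⟩
      · exact ⟨(s, true), by simp [hf]⟩
      · exact ⟨(s, false), by simp [hf]⟩
    exact Set.Finite.subset (Set.finite_range _) this |>.to_subtype
  have hle := Nat.card_le_card_of_injective g hg
  haveI : Fintype X := Fintype.ofFinite X
  rw [Nat.card_eq_fintype_card (α := Option X), Fintype.card_option, ← Nat.card_eq_fintype_card] at hle
  -- `Nat.card X = |S_F| − 1`
  haveI := Fintype.ofFinite T
  have hX : Nat.card X = Nat.card {t : T // rel t = F} - 1 := by
    rw [Nat.card_eq_fintype_card, Nat.card_eq_fintype_card, Fintype.card_subtype, Fintype.card_subtype]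
    have hfilter : (Finset.univ.filter fun s : T => rel s = F ∧ s ≠ head F) =
        (Finset.univ.filter fun s : T => rel s = F).erase (head F) := by
      ext s
      simp only [Finset.mem_filter, Finset.mem_univ, true_and, Finset.mem_erase]
      tauto
    rw [hfilter, Finset.card_erase_of_mem]
    simpa using hhead F
  rw [hF, ← hX] at hle
  omega

end Literature.AlgebraicGeometry.Hu2025.Proofs.S04ModelV

end
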